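import Summits.HubbardSuperconductivity.HubbardSuperconductivity.Theorems.BalabanIRBirComplexStableXYRFerroConeBridge
import Summits.HubbardSuperconductivity.HubbardSuperconductivity.Theorems.BalabanIRBirSliceXYOrderRP
import HarnessLib

/-!
# Crux `BirComplexStableXYR` (stmt-HubbardSuperconductivity-14845) on the real ferromagnetic cone —
# II. Ginibre comparison with the proved XY anchor: the restated engine HOLDS on the cone

Support theorem for the restated engine of route BalabanIR (crux 2R,
`Summit.HubbardSuperconductivity.HubbardSuperconductivity.Theses.BalabanIR.BirComplexStableXYR`), prover seat 0.
The crux asks, uniformly over a class of COMPLEX coercive window tables `c`, for `K₀, L₀` with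
`Z ≠ 0 ∧ Re(∫ O e^{-A} / Z) ≥ 1/2` at all even `L₀ ≤ L ≤ M`.  Here we settle its REAL FERROMAGNETIC FACE
(the planners' "ginibre-ferromagnetic-cone" support face, idea card
`Cruxes/BirComplexStableXY/Ideas/ginibre-ferromagnetic-cone.md`):

* `birComplexStableXYR_ferroCone_named` / **`birComplexStableXYR_ferroCone`** — for every window size
  `r ≥ 2` and every `c₀ > 0` there are `K₀, L₀` such that for all `K ≥ K₀`, every table `c` that is real
  (`Im c_n = 0`), symmetric (`c_{-n} = c_n`), Fourier-negative (`Re c_n ≤ 0` for `n ≠ 0`) and whose three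
  corner axis-bond coefficients `c_{δ_0 - δ_{e}}`, `e ∈ {e₁, e₂, e_τ}`, are `≤ -c₀`, and all even
  `L₀ ≤ L ≤ M`: `Z ≠ 0` and the slice order is `≥ 1/2` — the crux's conclusion with its `let`s verbatim.

Proof: by file I such a table is a generalised plane rotator (Ginibre model) on `U(1)^Λ` with non-negative
couplings `-K Re c_n` on the translated frequency characters, and the slice order is `L⁻⁴ Σ_{x,y}` of Ginibre
expectations of two-point characters; Ginibre's inequality
(`Literature.Probability.LatticeModels.ginibreExpect_reChar_mono`, Ginibre 1970) compares it from below with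
the same expectations for the reference couplings `K_ref · 𝟙{n is a corner axis bond}`, `K_ref = max K₀ᴬ 0`,
which are dominated termwise as soon as `K c₀ ≥ 3 K_ref`; the reference model is exactly the nearest-neighbour
XY model on `(ℤ/L)² × ℤ/M` at stiffness `K_ref`, whose slice order is `≥ 1/2` for `K_ref ≥ K₀ᴬ`, even
`L₀ᴬ ≤ L ≤ M`, by the route's proved anchor `Theses.BalabanIR.birSliceXYOrderRP_proof` (reflection positivity,
Fröhlich–Simon–Spencer).  `Z > 0` because the weight is a positive real.  Constants: `K₀ = 3 K_ref / c₀`,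
`L₀ = L₀ᴬ`.

What this says for the crux: on the real Fourier-negative cone the engine holds with `K₀` depending only on the
axis-bond floor `c₀` (not on `r` or the analyticity budget `B`); the content left in `BirComplexStableXYR` is the
sign/phase structure only (mixed-sign real remainders allowed by (C), and the (R)-odd imaginary terms), never
range, multi-body order or anisotropy.

References: J. Ginibre, *General formulation of Griffiths' inequalities*, Comm. Math. Phys. 16 (1970) 310–328
[Ginibre1970]; J. Fröhlich, B. Simon, T. Spencer, Comm. Math. Phys. 50 (1976) 79–95 [FrohlichSimonSpencer1976];
S. Friedli, Y. Velenik, *Statistical Mechanics of Lattice Systems*, CUP 2017, §3.8, §10.5 [FriedliVelenik2017].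
-/

noncomputable section

namespace Summit.HubbardSuperconductivity.HubbardSuperconductivity.Theorems

open scoped BigOperators ComplexConjugate
open MeasureTheory Literature.Probability.LatticeModels
open Summit.HubbardSuperconductivity.BirComplexStableXYNegative

section FerroCone

variable {r : ℕ}

/-- Pairing of an axis-bond frequency `δ_{w₀} - δ_{w₁}` with a configuration: `Σ_w n_w ψ_w = ψ_{w₀} - ψ_{w₁}`. -/
theorem ferro_sum_single_sub_single_mul (w₀ w₁ : W r) (ψ : W r → ℝ) :
    (∑ w, (((Pi.single w₀ 1 - Pi.single w₁ 1 : Freq r) w : ℤ) : ℝ) * ψ w) = ψ w₀ - ψ w₁ := by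
  simp [Pi.single_apply, sub_mul, Finset.sum_sub_distrib]

/-- **The reference couplings are the XY anchor.** With couplings `K_ref` on three frequencies `n₁, n₂, n₃`
pairing like the corner axis bonds `δ_{w₀} - δ_{wᵢ}` (and `0` elsewhere) the Ginibre weight at `e^{iθ}` is the
nearest-neighbour XY weight `exp(K_ref Σ_s [cos(θ_s - θ_{s+e₁}) + cos(θ_s - θ_{s+e₂}) + cos(θ_s - θ_{s+e_τ})])` of
`BirSliceXYOrderRP`. [folklore] -/
theorem ferro_refWeight_eq (Kref : ℝ) {L M : ℕ} [NeZero L] [NeZero M]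
    (χ : (Λ L M × Freq r) → ((Λ L M → Circle) →ₜ* Circle))
    (hχ : ∀ s n u, χ (s, n) u = ∏ w, u (sh L M s w) ^ (n w)) (S : Finset (Freq r)) (w₀ w₁ w₂ w₃ : W r)
    (hs₀ : ∀ s : Λ L M, sh L M s w₀ = s) (hs₁ : ∀ s : Λ L M, sh L M s w₁ = (s.1 + ![1, 0], s.2))
    (hs₂ : ∀ s : Λ L M, sh L M s w₂ = (s.1 + ![0, 1], s.2)) (hs₃ : ∀ s : Λ L M, sh L M s w₃ = (s.1, s.2 + 1))
    (n₁ n₂ n₃ : Freq r) (hν₁ : ∀ ψ : W r → ℝ, (∑ w, ((n₁ w : ℤ) : ℝ) * ψ w) = ψ w₀ - ψ w₁)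
    (hν₂ : ∀ ψ : W r → ℝ, (∑ w, ((n₂ w : ℤ) : ℝ) * ψ w) = ψ w₀ - ψ w₂)
    (hν₃ : ∀ ψ : W r → ℝ, (∑ w, ((n₃ w : ℤ) : ℝ) * ψ w) = ψ w₀ - ψ w₃)
    (hn₁ : n₁ ∈ S) (hn₂ : n₂ ∈ S) (hn₃ : n₃ ∈ S) (θ : Λ L M → ℝ) :
    ginibreWeight (fun i : Λ L M × ↥S => χ (i.1, (i.2 : Freq r)))
        (fun i => Kref * ((if (i.2 : Freq r) = n₁ then 1 else 0) + (if (i.2 : Freq r) = n₂ then 1 else 0) +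
          (if (i.2 : Freq r) = n₃ then 1 else 0)))
        (fun v => Circle.exp (θ v)) =
      Real.exp (Kref * ∑ s : Λ L M, (Real.cos (θ s - θ (s.1 + ![1, 0], s.2)) +
        Real.cos (θ s - θ (s.1 + ![0, 1], s.2)) + Real.cos (θ s - θ (s.1, s.2 + 1)))) := by
  rw [ginibreWeight, ferro_ginibreHamiltonian_exp χ hχ]
  congr 1
  rw [Finset.mul_sum]
  refine Finset.sum_congr rfl fun s _ => ?_
  -- the inner sum over `↥S` collapses to the three frequencies
  have key : ∀ g : Freq r → ℝ,
      ∑ n : ↥S, Kref * ((if (n : Freq r) = n₁ then 1 else 0) + (if (n : Freq r) = n₂ then 1 else 0) +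
          (if (n : Freq r) = n₃ then 1 else 0)) * g n = Kref * (g n₁ + g n₂ + g n₃) := by
    intro g
    rw [Finset.sum_coe_sort S (fun n : Freq r =>
      Kref * ((if n = n₁ then 1 else 0) + (if n = n₂ then 1 else 0) + (if n = n₃ then 1 else 0)) * g n)]
    have hpt : ∀ n : Freq r,
        Kref * ((if n = n₁ then 1 else 0) + (if n = n₂ then 1 else 0) + (if n = n₃ then 1 else 0)) * g n =
        Kref * ((if n = n₁ then g n else 0) + (if n = n₂ then g n else 0) + (if n = n₃ then g n else 0)) := by
      intro n
      split_ifs <;> ring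
    simp_rw [hpt]
    rw [← Finset.mul_sum, Finset.sum_add_distrib, Finset.sum_add_distrib, Finset.sum_ite_eq',
      Finset.sum_ite_eq', Finset.sum_ite_eq', if_pos hn₁, if_pos hn₂, if_pos hn₃]
  dsimp only
  rw [key (fun n : Freq r => Real.cos (∑ w, ((n w : ℤ) : ℝ) * θ (sh L M s w))), hν₁, hν₂, hν₃,
    hs₀, hs₁, hs₂, hs₃]

/-- **The restated engine on the real ferromagnetic cone (named form).**  Over the named pieces `partZ`,
`action`, `cube` of the crux: for corner sites `w₀ = (0,0,0)`, `w₁ = (1,0,0)`, `w₂ = (0,1,0)`, `w₃ = (0,0,1)` of the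
window and every `c₀ > 0` there are `K₀, L₀` such that every real, symmetric, Fourier-negative table whose three
corner axis-bond coefficients are `≤ -c₀` has, for `K ≥ K₀` and all even `L₀ ≤ L ≤ M`, `Z ≠ 0` and slice order
`≥ 1/2`.  (Ginibre 1970 monotonicity above the anchor `birSliceXYOrderRP_proof`.) [cite: Ginibre1970, main theorem with the plane-rotator example] -/
theorem birComplexStableXYR_ferroCone_named (w₀ w₁ w₂ w₃ : W r)
    (hw₀ : (w₀.1 : ℕ) = 0 ∧ (w₀.2.1 : ℕ) = 0 ∧ (w₀.2.2 : ℕ) = 0)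
    (hw₁ : (w₁.1 : ℕ) = 1 ∧ (w₁.2.1 : ℕ) = 0 ∧ (w₁.2.2 : ℕ) = 0)
    (hw₂ : (w₂.1 : ℕ) = 0 ∧ (w₂.2.1 : ℕ) = 1 ∧ (w₂.2.2 : ℕ) = 0)
    (hw₃ : (w₃.1 : ℕ) = 0 ∧ (w₃.2.1 : ℕ) = 0 ∧ (w₃.2.2 : ℕ) = 1)
    (n₁ n₂ n₃ : Freq r) (e₁ : n₁ = (Pi.single w₀ 1 : Freq r) - Pi.single w₁ 1)
    (e₂ : n₂ = (Pi.single w₀ 1 : Freq r) - Pi.single w₂ 1) (e₃ : n₃ = (Pi.single w₀ 1 : Freq r) - Pi.single w₃ 1)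
    {c₀ : ℝ} (hc₀ : 0 < c₀) :
    ∃ K₀ : ℝ, ∃ L₀ : ℕ, ∀ K : ℝ, K₀ ≤ K → ∀ c : Table r,
      (∀ n, (c n).im = 0) → (∀ n, c (-n) = c n) → (∀ n, n ≠ 0 → (c n).re ≤ 0) →
      (c n₁).re ≤ -c₀ → (c n₂).re ≤ -c₀ → (c n₃).re ≤ -c₀ →
      ∀ (L M : ℕ) [NeZero L] [NeZero M], L₀ ≤ L → L ≤ M → Even L → Even M →
        partZ K c L M ≠ 0 ∧ (1/2 : ℝ) ≤
          ((∫ θ in cube L M, (((‖∑ x : TorusSite 2 L, Complex.exp (Complex.I * (θ (x, 0) : ℂ))‖ ^ 2 /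
              (L : ℝ) ^ 4 : ℝ)) : ℂ) * Complex.exp (-(action K c L M θ))) / partZ K c L M).re := by
  obtain ⟨K₀A, L₀A, hanch⟩ := birSliceXYOrderRP_proof
  set Kref : ℝ := max K₀A 0 with hKref
  have hKref0 : 0 ≤ Kref := le_max_right _ _
  refine ⟨3 * Kref / c₀, L₀A, ?_⟩
  intro K hK c hre hsy hfe hD₁ hD₂ hD₃ L M _ _ hL hLM hLe hMe
  have hK0 : 0 ≤ K := le_trans (by positivity) hK
  have hKc : 3 * Kref ≤ K * c₀ := by rwa [div_le_iff₀ hc₀] at hK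
  -- the anchor at stiffness `Kref`
  have hA := hanch Kref (le_max_left _ _) L M hL hLM hLe hMe
  dsimp only at hA
  -- window geometry of the corner sites
  obtain ⟨h00, h01, h02⟩ := hw₀
  obtain ⟨h10, h11, h12⟩ := hw₁
  obtain ⟨h20, h21, h22⟩ := hw₂
  obtain ⟨h30, h31, h32⟩ := hw₃
  have hs₀ : ∀ s : Λ L M, sh L M s w₀ = s := fun s => by
    refine Prod.ext ?_ ?_
    · funext i; fin_cases i <;> simp [sh, h00, h01, Matrix.vecHead, Matrix.vecTail]
    · simp [sh, h02]
  have hs₁ : ∀ s : Λ L M, sh L M s w₁ = (s.1 + ![1, 0], s.2) := fun s => by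
    refine Prod.ext ?_ ?_
    · funext i; fin_cases i <;> simp [sh, h10, h11, Matrix.vecHead, Matrix.vecTail]
    · simp [sh, h12]
  have hs₂ : ∀ s : Λ L M, sh L M s w₂ = (s.1 + ![0, 1], s.2) := fun s => by
    refine Prod.ext ?_ ?_
    · funext i; fin_cases i <;> simp [sh, h20, h21, Matrix.vecHead, Matrix.vecTail]
    · simp [sh, h22]
  have hs₃ : ∀ s : Λ L M, sh L M s w₃ = (s.1, s.2 + 1) := fun s => by
    refine Prod.ext ?_ ?_
    · funext i; fin_cases i <;> simp [sh, h30, h31, Matrix.vecHead, Matrix.vecTail]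
    · simp [sh, h32]
  have hw01 : w₁ ≠ w₀ := fun h => by
    have := congrArg (fun w : W r => (w.1 : ℕ)) h; simp [h00, h10] at this
  have hw02 : w₂ ≠ w₀ := fun h => by
    have := congrArg (fun w : W r => (w.2.1 : ℕ)) h; simp [h01, h21] at this
  have hw03 : w₃ ≠ w₀ := fun h => by
    have := congrArg (fun w : W r => (w.2.2 : ℕ)) h; simp [h02, h32] at this
  -- pairing identities of the corner axis-bond frequencies
  have hν₁ : ∀ ψ : W r → ℝ, (∑ w, ((n₁ w : ℤ) : ℝ) * ψ w) = ψ w₀ - ψ w₁ := fun ψ => by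
    rw [e₁]; exact ferro_sum_single_sub_single_mul w₀ w₁ ψ
  have hν₂ : ∀ ψ : W r → ℝ, (∑ w, ((n₂ w : ℤ) : ℝ) * ψ w) = ψ w₀ - ψ w₂ := fun ψ => by
    rw [e₂]; exact ferro_sum_single_sub_single_mul w₀ w₂ ψ
  have hν₃ : ∀ ψ : W r → ℝ, (∑ w, ((n₃ w : ℤ) : ℝ) * ψ w) = ψ w₀ - ψ w₃ := fun ψ => by
    rw [e₃]; exact ferro_sum_single_sub_single_mul w₀ w₃ ψ
  -- they are non-zero (the two sites differ) and lie in `S = supp c ∖ {0}`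
  have hne : ∀ {n : Freq r} {w' : W r}, w' ≠ w₀ →
      (∀ ψ : W r → ℝ, (∑ w, ((n w : ℤ) : ℝ) * ψ w) = ψ w₀ - ψ w') → n ≠ 0 := by
    intro n w' hw' hν h
    have := hν (fun w => if w = w₀ then 1 else 0)
    rw [h] at this
    simp [hw'] at this
  set S : Finset (Freq r) := c.support.erase 0 with hS
  have hmemS : ∀ {n : Freq r}, n ≠ 0 → (c n).re ≤ -c₀ → n ∈ S := by
    intro n hn hD
    show n ∈ c.support.erase 0
    rw [Finset.mem_erase, Finsupp.mem_support_iff]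
    refine ⟨hn, fun h => ?_⟩
    rw [h] at hD
    simp at hD
    linarith
  have hn₁ := hmemS (hne hw01 hν₁) hD₁
  have hn₂ := hmemS (hne hw02 hν₂) hD₂
  have hn₃ := hmemS (hne hw03 hν₃) hD₃
  -- the Ginibre model
  obtain ⟨χ, hχ⟩ := ferro_exists_freqChar (r := r) L M
  set χ' : Λ L M × ↥S → ((Λ L M → Circle) →ₜ* Circle) := fun i => χ (i.1, (i.2 : Freq r)) with hχ'
  set J : Λ L M × ↥S → ℝ := fun i => -(K * (c (i.2 : Freq r)).re) with hJ
  set Jref : Λ L M × ↥S → ℝ := fun i =>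
    Kref * ((if (i.2 : Freq r) = n₁ then 1 else 0) + (if (i.2 : Freq r) = n₂ then 1 else 0) +
      (if (i.2 : Freq r) = n₃ then 1 else 0)) with hJrefdef
  have hJnn : ∀ i, 0 ≤ J i := fun i => by
    have hi : (i.2 : Freq r) ∈ c.support.erase 0 := i.2.2
    rw [Finset.mem_erase] at hi
    have := hfe _ hi.1
    simp only [hJ]
    nlinarith
  have hbr : ∀ i : Λ L M × ↥S,
      0 ≤ ((if (i.2 : Freq r) = n₁ then (1:ℝ) else 0) + (if (i.2 : Freq r) = n₂ then 1 else 0) +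
        (if (i.2 : Freq r) = n₃ then 1 else 0)) ∧
      ((if (i.2 : Freq r) = n₁ then (1:ℝ) else 0) + (if (i.2 : Freq r) = n₂ then 1 else 0) +
        (if (i.2 : Freq r) = n₃ then 1 else 0)) ≤ 3 := fun i => by
    constructor <;> split_ifs <;> norm_num
  have hJrefnn : ∀ i, 0 ≤ Jref i := fun i => by
    simp only [hJrefdef]
    exact mul_nonneg hKref0 (hbr i).1
  have hJJ : ∀ i, Jref i ≤ J i := fun i => by
    rcases em ((i.2 : Freq r) = n₁ ∨ (i.2 : Freq r) = n₂ ∨ (i.2 : Freq r) = n₃) with h | h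
    · have hre' : (c (i.2 : Freq r)).re ≤ -c₀ := by
        rcases h with h | h | h <;> rw [h] <;> assumption
      have h3 : Jref i ≤ 3 * Kref := by
        simp only [hJrefdef]
        nlinarith [(hbr i).2, hKref0]
      have h4 : 3 * Kref ≤ J i := by
        simp only [hJ]
        have := mul_le_mul_of_nonneg_left hre' hK0
        linarith
      linarith
    · push Not at h
      simp only [hJrefdef, if_neg h.1, if_neg h.2.1, if_neg h.2.2, add_zero, mul_zero]
      exact hJnn i
  -- Ginibre's inequality, termwise in `(x, y)`
  set μ := torusHaar (Λ L M) with hμ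
  have hmono : ∀ x y : TorusSite 2 L,
      ginibreExpect μ χ' Jref (reChar (diffChar ((y, (0 : ZMod M)) : Λ L M) (x, 0))) ≤
        ginibreExpect μ χ' J (reChar (diffChar ((y, (0 : ZMod M)) : Λ L M) (x, 0))) := fun x y =>
    ginibreExpect_reChar_mono μ surjective_mul_self_torus χ' _ hJrefnn hJJ
  have hsum : (∑ x : TorusSite 2 L, ∑ y : TorusSite 2 L,
      ginibreExpect μ χ' Jref (reChar (diffChar ((y, (0 : ZMod M)) : Λ L M) (x, 0)))) / (L : ℝ) ^ 4 ≤
      (∑ x : TorusSite 2 L, ∑ y : TorusSite 2 L,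
      ginibreExpect μ χ' J (reChar (diffChar ((y, (0 : ZMod M)) : Λ L M) (x, 0)))) / (L : ℝ) ^ 4 :=
    div_le_div_of_nonneg_right (Finset.sum_le_sum fun x _ => Finset.sum_le_sum fun y _ => hmono x y)
      (by positivity)
  -- continuity facts
  have hgc : Continuous (ginibreWeight χ' J) := continuous_ginibreWeight χ' J
  have hgrc : Continuous (ginibreWeight χ' Jref) := continuous_ginibreWeight χ' Jref
  have hOc : Continuous (fun u : Λ L M → Circle => (∑ x : TorusSite 2 L, ∑ y : TorusSite 2 L,
      reChar (diffChar ((y, (0 : ZMod M)) : Λ L M) (x, 0)) u) / (L : ℝ) ^ 4) := by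
    refine Continuous.div_const (continuous_finsetSum _ fun x _ =>
      continuous_finsetSum _ fun y _ => continuous_reChar _) _
  -- the reference ratio is the anchor's slice order
  set C : ℝ := Real.exp (-(K * Fintype.card (Λ L M) * (c 0).re)) with hC
  have hCpos : 0 < C := Real.exp_pos _
  have href : (∫ θ in cube L M, ‖∑ x : TorusSite 2 L, Complex.exp (Complex.I * (θ (x, 0) : ℂ))‖ ^ 2 /
        (L : ℝ) ^ 4 * Real.exp (Kref * ∑ s : Λ L M, (Real.cos (θ s - θ (s.1 + ![1, 0], s.2)) +
          Real.cos (θ s - θ (s.1 + ![0, 1], s.2)) + Real.cos (θ s - θ (s.1, s.2 + 1))))) /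
      (∫ θ in cube L M, Real.exp (Kref * ∑ s : Λ L M, (Real.cos (θ s - θ (s.1 + ![1, 0], s.2)) +
          Real.cos (θ s - θ (s.1 + ![0, 1], s.2)) + Real.cos (θ s - θ (s.1, s.2 + 1))))) =
      (∑ x : TorusSite 2 L, ∑ y : TorusSite 2 L,
        ginibreExpect μ χ' Jref (reChar (diffChar ((y, (0 : ZMod M)) : Λ L M) (x, 0)))) / (L : ℝ) ^ 4 := by
    rw [← ferro_torus_ratio_eq_sum_ginibreExpect L M χ' Jref,
      ← ferro_cube_ratio_eq_torus_ratio L M (fun u => (∑ x : TorusSite 2 L, ∑ y : TorusSite 2 L,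
          reChar (diffChar ((y, (0 : ZMod M)) : Λ L M) (x, 0)) u) / (L : ℝ) ^ 4 * ginibreWeight χ' Jref u)
        (fun u => ginibreWeight χ' Jref u) (hOc.mul hgrc) hgrc]
    congr 1
    · refine setIntegral_congr_fun (by rw [cube]; exact MeasurableSet.univ_pi fun _ => measurableSet_Icc)
        fun θ _ => ?_
      rw [ferro_sliceObs_eq L M θ, ferro_refWeight_eq Kref χ hχ S w₀ w₁ w₂ w₃ hs₀ hs₁ hs₂ hs₃ n₁ n₂ n₃ hν₁ hν₂ hν₃ hn₁ hn₂ hn₃ θ]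
    · refine setIntegral_congr_fun (by rw [cube]; exact MeasurableSet.univ_pi fun _ => measurableSet_Icc)
        fun θ _ => ?_
      rw [ferro_refWeight_eq Kref χ hχ S w₀ w₁ w₂ w₃ hs₀ hs₁ hs₂ hs₃ n₁ n₂ n₃ hν₁ hν₂ hν₃ hn₁ hn₂ hn₃ θ]
  -- the table's weight, partition function and numerator are real
  have hw : ∀ θ : Λ L M → ℝ, Complex.exp (-(action K c L M θ)) =
      ((C * ginibreWeight χ' J (fun v => Circle.exp (θ v)) : ℝ) : ℂ) := fun θ => by
    rw [ferro_cexp_neg_action K c hre hsy L M θ, ferro_weight_eq_ginibreWeight K c χ hχ θ]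
  have hZ : partZ K c L M = ((∫ θ in cube L M, C * ginibreWeight χ' J (fun v => Circle.exp (θ v)) : ℝ) : ℂ) := by
    rw [partZ, ← integral_complex_ofReal]
    exact integral_congr_ae (ae_of_all _ fun θ => hw θ)
  have hN : (∫ θ in cube L M, (((‖∑ x : TorusSite 2 L, Complex.exp (Complex.I * (θ (x, 0) : ℂ))‖ ^ 2 /
        (L : ℝ) ^ 4 : ℝ)) : ℂ) * Complex.exp (-(action K c L M θ))) =
      ((∫ θ in cube L M, (∑ x : TorusSite 2 L, ∑ y : TorusSite 2 L,
        reChar (diffChar ((y, (0 : ZMod M)) : Λ L M) (x, 0)) (fun v => Circle.exp (θ v))) / (L : ℝ) ^ 4 *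
          (C * ginibreWeight χ' J (fun v => Circle.exp (θ v))) : ℝ) : ℂ) := by
    rw [← integral_complex_ofReal]
    refine integral_congr_ae (ae_of_all _ fun θ => ?_)
    dsimp only
    rw [hw θ, ferro_sliceObs_eq L M θ]
    push_cast
    ring
  -- positivity of `Z`
  have hZpos : 0 < ∫ θ in cube L M, C * ginibreWeight χ' J (fun v => Circle.exp (θ v)) := by
    rw [cube, setIntegral_angleCube_comp_exp (fun u => C * ginibreWeight χ' J u)
      ((continuous_const.mul hgc).aestronglyMeasurable), smul_eq_mul, integral_const_mul]
    refine mul_pos (by positivity) (mul_pos hCpos ?_)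
    exact integral_exp_pos (integrable_torusHaar_of_continuous hgc)
  refine ⟨?_, ?_⟩
  · rw [hZ]
    exact_mod_cast hZpos.ne'
  -- the slice order is the Ginibre average, `≥` the reference average `≥ 1/2`
  rw [hN, hZ, ← Complex.ofReal_div, Complex.ofReal_re]
  have hratio : (∫ θ in cube L M, (∑ x : TorusSite 2 L, ∑ y : TorusSite 2 L,
        reChar (diffChar ((y, (0 : ZMod M)) : Λ L M) (x, 0)) (fun v => Circle.exp (θ v))) / (L : ℝ) ^ 4 *
          (C * ginibreWeight χ' J (fun v => Circle.exp (θ v)))) /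
      (∫ θ in cube L M, C * ginibreWeight χ' J (fun v => Circle.exp (θ v))) =
      (∑ x : TorusSite 2 L, ∑ y : TorusSite 2 L,
        ginibreExpect μ χ' J (reChar (diffChar ((y, (0 : ZMod M)) : Λ L M) (x, 0)))) / (L : ℝ) ^ 4 := by
    rw [ferro_cube_ratio_eq_torus_ratio L M (fun u => (∑ x : TorusSite 2 L, ∑ y : TorusSite 2 L,
        reChar (diffChar ((y, (0 : ZMod M)) : Λ L M) (x, 0)) u) / (L : ℝ) ^ 4 * (C * ginibreWeight χ' J u))
        (fun u => C * ginibreWeight χ' J u) (hOc.mul (continuous_const.mul hgc)) (continuous_const.mul hgc),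
      ← ferro_torus_ratio_eq_sum_ginibreExpect L M χ' J]
    have e1 : (fun u : Λ L M → Circle => (∑ x : TorusSite 2 L, ∑ y : TorusSite 2 L,
        reChar (diffChar ((y, (0 : ZMod M)) : Λ L M) (x, 0)) u) / (L : ℝ) ^ 4 * (C * ginibreWeight χ' J u)) =
        fun u => C * ((∑ x : TorusSite 2 L, ∑ y : TorusSite 2 L,
          reChar (diffChar ((y, (0 : ZMod M)) : Λ L M) (x, 0)) u) / (L : ℝ) ^ 4 * ginibreWeight χ' J u) := by
      funext u; ring
    rw [e1, integral_const_mul, integral_const_mul, mul_div_mul_left _ _ hCpos.ne']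
  rw [hratio]
  exact le_trans (hA.trans_eq href) hsum

/-- **`BirComplexStableXYR` holds on the real ferromagnetic cone** (the crux's conclusion with its `let`s
verbatim; hypotheses: the admissible class of the crux is replaced by the cone conditions).  For every window
size `r ≥ 2` and `c₀ > 0` there are `K₀, L₀` such that for all `K ≥ K₀`, every finite Fourier table `c` on
`W_r = Fin r × Fin r × Fin r` which is real (`Im c_n = 0`), symmetric (`c_{-n} = c_n`), Fourier-negative
(`n ≠ 0 → Re c_n ≤ 0`) and has its three corner axis-bond coefficients `Re c_{δ_{(0,0,0)} - δ_{(1,0,0)}}`,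
`Re c_{δ_{(0,0,0)} - δ_{(0,1,0)}}`, `Re c_{δ_{(0,0,0)} - δ_{(0,0,1)}}` all `≤ -c₀`, and all even `L₀ ≤ L ≤ M`:
the engine's partition function `Z = ∫_{[0,2π]^Λ} e^{-A}` is non-zero and the equal-time slice order
`Re(∫ O e^{-A} / Z)`, `O = |L⁻² Σ_x e^{iθ(x,0)}|²`, is at least `1/2`.  Ginibre's inequality (1970) above the
reflection-positivity anchor `birSliceXYOrderRP_proof`; `K₀ = 3 max(K₀ᴬ,0)/c₀`, `L₀ = L₀ᴬ`.
[cite: Ginibre1970, main theorem with the plane-rotator example; FrohlichSimonSpencer1976, Thm. 3.1] -/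
theorem birComplexStableXYR_ferroCone :
    ∀ (r : ℕ) (c₀ : ℝ) (hr : 2 ≤ r), 0 < c₀ → ∃ K₀ : ℝ, ∃ L₀ : ℕ, ∀ K : ℝ, K₀ ≤ K →
    ∀ c : ((Fin r × Fin r × Fin r) → ℤ) →₀ ℂ,
    (∀ n : (Fin r × Fin r × Fin r) → ℤ, (c n).im = 0) →
    (∀ n : (Fin r × Fin r × Fin r) → ℤ, c (-n) = c n) →
    (∀ n : (Fin r × Fin r × Fin r) → ℤ, n ≠ 0 → (c n).re ≤ 0) →
    (c (Pi.single ((⟨0, by omega⟩ : Fin r), (⟨0, by omega⟩ : Fin r), (⟨0, by omega⟩ : Fin r)) 1 -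
        Pi.single ((⟨1, by omega⟩ : Fin r), (⟨0, by omega⟩ : Fin r), (⟨0, by omega⟩ : Fin r)) 1)).re ≤ -c₀ →
    (c (Pi.single ((⟨0, by omega⟩ : Fin r), (⟨0, by omega⟩ : Fin r), (⟨0, by omega⟩ : Fin r)) 1 -
        Pi.single ((⟨0, by omega⟩ : Fin r), (⟨1, by omega⟩ : Fin r), (⟨0, by omega⟩ : Fin r)) 1)).re ≤ -c₀ →
    (c (Pi.single ((⟨0, by omega⟩ : Fin r), (⟨0, by omega⟩ : Fin r), (⟨0, by omega⟩ : Fin r)) 1 -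
        Pi.single ((⟨0, by omega⟩ : Fin r), (⟨0, by omega⟩ : Fin r), (⟨1, by omega⟩ : Fin r)) 1)).re ≤ -c₀ →
    ∀ (L M : ℕ) [NeZero L] [NeZero M], L₀ ≤ L → L ≤ M → Even L → Even M →
    let sh : (Literature.Probability.LatticeModels.TorusSite 2 L × ZMod M) → (Fin r × Fin r × Fin r) → (Literature.Probability.LatticeModels.TorusSite 2 L × ZMod M) := fun s w => (s.1 + ![((w.1 : ℕ) : ZMod L), ((w.2.1 : ℕ) : ZMod L)], s.2 + ((w.2.2 : ℕ) : ZMod M))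
    let F : ((Fin r × Fin r × Fin r) → ℝ) → ℂ := fun (φ : (Fin r × Fin r × Fin r) → ℝ) => c.sum (fun n a => a * Complex.exp (Complex.I * ((∑ w, (n w : ℝ) * φ w : ℝ) : ℂ)))
    let A : ((Literature.Probability.LatticeModels.TorusSite 2 L × ZMod M) → ℝ) → ℂ := fun θ => (K : ℂ) * ∑ s : (Literature.Probability.LatticeModels.TorusSite 2 L × ZMod M), F (fun w => θ (sh s w))
    let cube : Set ((Literature.Probability.LatticeModels.TorusSite 2 L × ZMod M) → ℝ) := Set.pi Set.univ (fun _ => Set.Icc (0:ℝ) (2 * Real.pi))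
    let Z : ℂ := MeasureTheory.integral (MeasureTheory.volume.restrict cube) (fun θ => Complex.exp (-(A θ)))
    let O : ((Literature.Probability.LatticeModels.TorusSite 2 L × ZMod M) → ℝ) → ℝ := fun θ => ‖∑ x : Literature.Probability.LatticeModels.TorusSite 2 L, Complex.exp (Complex.I * (θ (x, 0) : ℂ))‖ ^ 2 / (L : ℝ) ^ 4
    Z ≠ 0 ∧ (1/2 : ℝ) ≤ ((MeasureTheory.integral (MeasureTheory.volume.restrict cube) (fun θ => (O θ : ℂ) * Complex.exp (-(A θ)))) / Z).re := by
  intro r c₀ hr hc₀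
  obtain ⟨K₀, L₀, h⟩ := birComplexStableXYR_ferroCone_named (r := r)
    ((⟨0, by omega⟩ : Fin r), (⟨0, by omega⟩ : Fin r), (⟨0, by omega⟩ : Fin r))
    ((⟨1, by omega⟩ : Fin r), (⟨0, by omega⟩ : Fin r), (⟨0, by omega⟩ : Fin r))
    ((⟨0, by omega⟩ : Fin r), (⟨1, by omega⟩ : Fin r), (⟨0, by omega⟩ : Fin r))
    ((⟨0, by omega⟩ : Fin r), (⟨0, by omega⟩ : Fin r), (⟨1, by omega⟩ : Fin r))
    ⟨rfl, rfl, rfl⟩ ⟨rfl, rfl, rfl⟩ ⟨rfl, rfl, rfl⟩ ⟨rfl, rfl, rfl⟩ _ _ _ rfl rfl rfl hc₀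
  refine ⟨K₀, L₀, fun K hK c hre hsy hfe hD₁ hD₂ hD₃ L M _ _ hL hLM hLe hMe => ?_⟩
  have key := h K hK c hre hsy hfe hD₁ hD₂ hD₃ L M hL hLM hLe hMe
  dsimp only [partZ, action, genF, sh, cube] at key
  dsimp only
  exact key

end FerroCone

end Summit.HubbardSuperconductivity.HubbardSuperconductivity.Theorems

end
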